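import Literature.Dynamics.Ergodic.BirkhoffErgodicTheorem
import Mathlib.Algebra.Order.SuccPred.PartialSups
import Mathlib.Dynamics.BirkhoffSum.QuasiMeasurePreserving
import Mathlib.Dynamics.Ergodic.Function
import Mathlib.MeasureTheory.Constructions.BorelSpace.Order
import Mathlib.MeasureTheory.Function.ConditionalExpectation.Basic
import Mathlib.MeasureTheory.Integral.DominatedConvergence
import Mathlib.MeasureTheory.MeasurableSpace.Invariants
import HarnessLib

/-!
# Birkhoff's pointwise ergodic theorem — proofs (discharge of the named facts)

Topic `Literature/Dynamics/Ergodic`. This file PROVES the two named facts of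
`Literature/Dynamics/Ergodic/BirkhoffErgodicTheorem.lean`:
`birkhoff_ergodic_theorem_holds : birkhoff_ergodic_theorem` (Dajani–Kalle Thm 3.1.1, first part:
a.e. convergence of the Birkhoff averages of `φ ∈ L¹` to an integrable, `f`-invariant `f*` with
`∫ f* = ∫ φ`) and `birkhoff_ergodic_theorem_of_ergodic_holds : birkhoff_ergodic_theorem_of_ergodic`
(second part: for ergodic `f` the limit is `∫ φ dμ`). It is kept as a sibling `…Proofs` module so
that the statement file stays light; nothing here is a definition or a new named fact.

`birkhoff_ergodic_theorem_holds` and `birkhoff_ergodic_theorem_of_ergodic_holds` below prove the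
two facts, with the limit identified as `f* = E[φ | 𝓘]`, the conditional expectation on
Mathlib's σ-algebra `MeasurableSpace.invariants f` of `f`-invariant measurable sets — exactly
Dajani–Kalle Remark 3.1.1 (i) ("We claim that `f* = E_μ(f|𝓘)`"). This choice makes `f*`
STRICTLY invariant (`f* ∘ f = f*`, via `MeasurableSpace.comp_eq_of_measurable_invariants`) and
gives `∫ f* = ∫ f` for free (`MeasureTheory.integral_condExp`).

Proof route (a deliberate deviation from the printed one). Dajani–Kalle print the Kamae–Keane
proof (their Lemma 3.1.1 on finite sequences + truncation/stopping-time bookkeeping). We follow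
instead the shorter maximal-inequality road printed in Durrett, *Probability: Theory and
Examples* (5th ed., CUP 2019), §6.2: Theorem 6.2.1 (`(1/n) ∑_{m<n} X ∘ φ^m → E(X|𝓘)` a.s.),
proved from the maximal ergodic Lemma 6.2.2 "following Garsia (1965)" by the computation
`0 ≤ E(X*; D) = E(E(X|𝓘); D) - ε P(D) = -ε P(D)` for `X* = X - E(X|𝓘) - ε` on an invariant
set `D`. (The same architecture — running maxima `partialSups (birkhoffSum f g)`, a strictly
invariant "divergent set", `condExp` on `invariants f` — is that of the Mathlib pull request
leanprover-community/mathlib4#26923 by L. Viana Reis and O. Butterley, whose statement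
`ae_tendsto_birkhoffAverage_condExp` we reproduce; the Lean text below is written afresh against
this tree's Mathlib.) Every analytic ingredient is in Mathlib (`partialSups`, dominated
convergence, `condExp` on a sub-σ-algebra, `measurableSet_bddAbove_range`):

1. `partialSups_birkhoffSum_succ`: the running maxima `Mₙ = max_{k ≤ n} Sₖ` (`S₀ = 0`) satisfy
   `M_{n+1}(x) = max (0, g x + Mₙ(f x))`, hence `|M_{n+1}(x) - Mₙ(f x)| ≤ |g x|` and
   `M_{n+1}(x) - Mₙ(f x) = g x` as soon as `Mₙ(f x) ≥ -g x`.
2. `setIntegral_nonneg_of_not_bddAbove_birkhoffSum` (maximal inequality, divergent form): on the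
   strictly invariant measurable set `D = {x | supₙ Sₙ(x) = +∞}` one has `∫_D g ≥ 0`
   (`∫_D (M_{n+1} - Mₙ ∘ f) = ∫_D M_{n+1} - ∫_D Mₙ ≥ 0` by invariance of `D` and measure
   preservation; pass to the limit by dominated convergence).
3. `ae_eventually_birkhoffAverage_lt`: applied to `h = g - E[g|𝓘] - ε`, whose integral over its
   own divergent set `D_h ∈ 𝓘` is `-ε μ(D_h)` (defining property of `E[·|𝓘]`), step 2 forces
   `μ(D_h) = 0`; off `D_h` the sums of `h` are bounded above, so a.e. eventually
   `Aₙ g < E[g|𝓘] + 2ε` (uses the strict invariance `E[g|𝓘] ∘ f = E[g|𝓘]`).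
4. The same for `-g` (`E[-g|𝓘] = -E[g|𝓘]` a.e.) gives the lower bound; `ε = 1/(k+1)` over
   `k : ℕ` gives a.e. convergence for measurable `g`
   (`ae_tendsto_birkhoffAverage_condExp_of_measurable`), and an a.e.-modification removes the
   measurability assumption (`ae_tendsto_birkhoffAverage_condExp`).
5. Ergodic case: `f*` is a.e. invariant and (`Ergodic.ae_eq_const_of_ae_eq_comp_ae`) a.e. equal
   to a constant `c`; `∫ f* = ∫ φ` on a probability space gives `c = ∫ φ dμ`.

## References

* R. Durrett, *Probability: Theory and Examples*, 5th ed., Cambridge Series in Statistical and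
  Probabilistic Mathematics 49, CUP 2019, doi:10.1017/9781108591034: §6.2, Thm 6.2.1 (ergodic
  theorem, `E(X|𝓘)` form), Lemma 6.2.2 (maximal ergodic lemma, after Garsia 1965).
* K. Dajani, C. Kalle, *A First Course in Ergodic Theory*, CRC Press 2021,
  doi:10.1201/9780429276019: §3.1, Thm 3.1.1, Lemma 3.1.1 (Kamae–Keane proof), Remark 3.1.1 (i).
* A. M. Garsia, *A simple proof of E. Hopf's maximal ergodic theorem*, J. Math. Mech. 14 (1965)
  381–382.
* G. D. Birkhoff, *Proof of the ergodic theorem*, Proc. Nat. Acad. Sci. USA 17 (1931) 656–660.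
* L. Viana Reis, O. Butterley, Mathlib pull request leanprover-community/mathlib4#26923
  "feat(Dynamics/BirkhoffSum): add the pointwise ergodic theorem (Birkhoff's)" (2025–26,
  Apache-2.0): same architecture (`partialSups (birkhoffSum f g)`, divergent set, `condExp` on
  `invariants f`).
-/

noncomputable section

open MeasureTheory Filter Topology Set
open MeasurableSpace (invariants invariants_le comp_eq_of_measurable_invariants)

namespace Literature.Dynamics.Ergodic

universe u

section MaximalInequality

variable {α : Type*}

/-- Recursion for the running maximum `Mₙ(x) = max_{0 ≤ k ≤ n} Sₖ(x)` of the Birkhoff sums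
`Sₖ = birkhoffSum f g k` (note `S₀ = 0`): `M_{n+1}(x) = max (0, g x + Mₙ(f x))`. [folklore] -/
theorem partialSups_birkhoffSum_succ (f : α → α) (g : α → ℝ) (n : ℕ) (x : α) :
    partialSups (birkhoffSum f g) (n + 1) x =
      max 0 (g x + partialSups (birkhoffSum f g) n (f x)) := by
  induction n with
  | zero =>
    rw [partialSups_add_one, Pi.sup_apply, partialSups_zero, zero_add, birkhoffSum_zero,
      birkhoffSum_zero, birkhoffSum_one, add_zero]
  | succ n ih =>
    rw [partialSups_add_one, Pi.sup_apply, ih, partialSups_add_one, Pi.sup_apply,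
      birkhoffSum_succ' f g (n + 1) x, ← max_add_add_left, max_assoc]

/-- `0 ≤ Mₙ(x)` since `S₀ = 0`. [folklore] -/
theorem partialSups_birkhoffSum_nonneg (f : α → α) (g : α → ℝ) (n : ℕ) (x : α) :
    0 ≤ partialSups (birkhoffSum f g) n x := by
  have h := le_partialSups_of_le (birkhoffSum f g) (Nat.zero_le n)
  simpa [birkhoffSum_zero] using h x

/-- The increment `M_{n+1}(x) - Mₙ(f x)` is dominated by `|g x|`. [folklore] -/
theorem abs_partialSups_birkhoffSum_succ_sub_le (f : α → α) (g : α → ℝ) (n : ℕ) (x : α) :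
    |partialSups (birkhoffSum f g) (n + 1) x - partialSups (birkhoffSum f g) n (f x)| ≤ |g x| := by
  rw [partialSups_birkhoffSum_succ]
  have h0 := partialSups_birkhoffSum_nonneg f g n (f x)
  rcases le_total 0 (g x + partialSups (birkhoffSum f g) n (f x)) with h | h
  · rw [max_eq_right h, add_sub_cancel_right]
  · rw [max_eq_left h, zero_sub, abs_neg, abs_of_nonneg h0]
    calc partialSups (birkhoffSum f g) n (f x) ≤ -g x := by linarith
      _ ≤ |g x| := neg_le_abs (g x)

/-- The Birkhoff sums along the orbit of `f x` are bounded above iff those along the orbit of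
`x` are (`S_{n+1}(x) = g x + Sₙ(f x)`). [folklore] -/
theorem bddAbove_range_birkhoffSum_apply_iff (f : α → α) (g : α → ℝ) (x : α) :
    BddAbove (range fun n => birkhoffSum f g n (f x)) ↔
      BddAbove (range fun n => birkhoffSum f g n x) := by
  constructor
  · rintro ⟨B, hB⟩
    refine ⟨max 0 (g x + B), ?_⟩
    rintro _ ⟨n, rfl⟩
    cases n with
    | zero => simp [birkhoffSum_zero]
    | succ n =>
      have hn : birkhoffSum f g n (f x) ≤ B := hB ⟨n, rfl⟩
      show birkhoffSum f g (n + 1) x ≤ max 0 (g x + B)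
      rw [birkhoffSum_succ']
      exact le_max_of_le_right (by linarith)
  · rintro ⟨B, hB⟩
    refine ⟨B - g x, ?_⟩
    rintro _ ⟨n, rfl⟩
    have hn : birkhoffSum f g (n + 1) x ≤ B := hB ⟨n + 1, rfl⟩
    show birkhoffSum f g n (f x) ≤ B - g x
    rw [birkhoffSum_succ'] at hn
    linarith

variable [MeasurableSpace α] {f : α → α} {g : α → ℝ} {μ : Measure α}

/-- Birkhoff sums of a measurable observable along a measurable map are measurable. [folklore] -/
theorem measurable_birkhoffSum (hf : Measurable f) (hg : Measurable g) (n : ℕ) :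
    Measurable (birkhoffSum f g n) := by
  show Measurable fun x => ∑ k ∈ Finset.range n, g (f^[k] x)
  exact Finset.measurable_sum _ fun k _ => hg.comp (hf.iterate k)

/-- Running maxima of Birkhoff sums are measurable. [folklore] -/
theorem measurable_partialSups_birkhoffSum (hf : Measurable f) (hg : Measurable g) (n : ℕ) :
    Measurable (partialSups (birkhoffSum f g) n) := by
  induction n with
  | zero => rw [partialSups_zero]; exact measurable_birkhoffSum hf hg 0
  | succ n ih =>
    rw [partialSups_add_one]
    exact ih.sup (measurable_birkhoffSum hf hg (n + 1))

/-- The "divergent set" `{x | sup_n Sₙ(x) = +∞}` is measurable. [folklore] -/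
theorem measurableSet_not_bddAbove_birkhoffSum (hf : Measurable f) (hg : Measurable g) :
    MeasurableSet {x | ¬ BddAbove (range fun n => birkhoffSum f g n x)} :=
  (measurableSet_bddAbove_range fun n => measurable_birkhoffSum hf hg n).compl

/-- The divergent set is strictly invariant, i.e. measurable for the invariant σ-algebra
`MeasurableSpace.invariants f`. [folklore] -/
theorem measurableSet_invariants_not_bddAbove_birkhoffSum (hf : Measurable f) (hg : Measurable g) :
    MeasurableSet[invariants f] {x | ¬ BddAbove (range fun n => birkhoffSum f g n x)} :=
  ⟨measurableSet_not_bddAbove_birkhoffSum hf hg,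
    by ext x; simp only [mem_preimage, mem_setOf_eq, bddAbove_range_birkhoffSum_apply_iff]⟩

/-- Birkhoff sums of an integrable observable along a measure preserving map are integrable.
[folklore] -/
theorem integrable_birkhoffSum (hf : MeasurePreserving f μ μ) (hg : Integrable g μ) (n : ℕ) :
    Integrable (birkhoffSum f g n) μ := by
  show Integrable (fun x => ∑ k ∈ Finset.range n, g (f^[k] x)) μ
  exact integrable_finsetSum _ fun k _ => (hf.iterate k).integrable_comp_of_integrable hg

/-- Running maxima of Birkhoff sums of an integrable observable are integrable. [folklore] -/
theorem integrable_partialSups_birkhoffSum (hf : MeasurePreserving f μ μ) (hg : Integrable g μ)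
    (n : ℕ) : Integrable (partialSups (birkhoffSum f g) n) μ := by
  induction n with
  | zero => rw [partialSups_zero]; exact integrable_birkhoffSum hf hg 0
  | succ n ih =>
    rw [partialSups_add_one]
    exact ih.sup (integrable_birkhoffSum hf hg (n + 1))

/-- **Maximal ergodic inequality, divergent form** (a variant of Durrett 2019, Lemma 6.2.2,
"maximal ergodic lemma", with Garsia's 1965 argument): for a measure preserving `f` and an
integrable measurable `g`, the integral of `g` over the divergent set
`D = {x | sup_n Sₙ g(x) = +∞}` is nonnegative. Proof: `Δₙ(x) = M_{n+1}(x) - Mₙ(f x)` satisfies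
`|Δₙ| ≤ |g|`, `Δₙ → g` on `D`, and `∫_D Δₙ = ∫_D M_{n+1} - ∫_D Mₙ ≥ 0` by invariance of `D`;
conclude by dominated convergence. [folklore] -/
theorem setIntegral_nonneg_of_not_bddAbove_birkhoffSum (hf : MeasurePreserving f μ μ)
    (hg : Integrable g μ) (hgm : Measurable g) :
    0 ≤ ∫ x in {x | ¬ BddAbove (range fun n => birkhoffSum f g n x)}, g x ∂μ := by
  set D := {x | ¬ BddAbove (range fun n => birkhoffSum f g n x)} with hD
  have hDm : MeasurableSet D := measurableSet_not_bddAbove_birkhoffSum hf.measurable hgm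
  have hDinv : f ⁻¹' D = D := by
    ext x; simp only [D, mem_preimage, mem_setOf_eq, bddAbove_range_birkhoffSum_apply_iff]
  have hMint : ∀ n, Integrable (partialSups (birkhoffSum f g) n) μ := fun n =>
    integrable_partialSups_birkhoffSum hf hg n
  have hMmeas : ∀ n, Measurable (partialSups (birkhoffSum f g) n) := fun n =>
    measurable_partialSups_birkhoffSum hf.measurable hgm n
  -- the dynamics restricted to the invariant set `D` is measure preserving
  have hfD : MeasurePreserving f (μ.restrict D) (μ.restrict D) := by
    have := hf.restrict_preimage hDm
    rwa [hDinv] at this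
  have hMfint : ∀ n, Integrable (fun x => partialSups (birkhoffSum f g) n (f x)) (μ.restrict D) :=
    fun n => hfD.integrable_comp_of_integrable (hMint n).restrict
  have hΔint : ∀ n, Integrable (fun x => partialSups (birkhoffSum f g) (n + 1) x -
      partialSups (birkhoffSum f g) n (f x)) (μ.restrict D) :=
    fun n => (hMint (n + 1)).restrict.sub (hMfint n)
  -- (a) the integrals of the increments over `D` are nonnegative
  have hnonneg : ∀ n, 0 ≤ ∫ x in D, (partialSups (birkhoffSum f g) (n + 1) x -
      partialSups (birkhoffSum f g) n (f x)) ∂μ := by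
    intro n
    rw [integral_sub (hMint (n + 1)).restrict (hMfint n)]
    have h1 : ∫ x in D, partialSups (birkhoffSum f g) n (f x) ∂μ =
        ∫ x in D, partialSups (birkhoffSum f g) n x ∂μ := by
      have := integral_map (μ := μ.restrict D) hfD.measurable.aemeasurable
        (hMmeas n).aestronglyMeasurable
      rw [hfD.map_eq] at this
      exact this.symm
    rw [h1, sub_nonneg]
    exact integral_mono (hMint n).restrict (hMint (n + 1)).restrict
      fun x => (partialSups (birkhoffSum f g)).monotone (Nat.le_succ n) x
  -- (b) on `D` the increments converge to `g`
  have hlim : ∀ᵐ x ∂(μ.restrict D), Tendsto (fun n => partialSups (birkhoffSum f g) (n + 1) x -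
      partialSups (birkhoffSum f g) n (f x)) atTop (𝓝 (g x)) := by
    rw [ae_restrict_iff' hDm]
    refine ae_of_all _ fun x hx => ?_
    have hx' : ¬ BddAbove (range fun n => birkhoffSum f g n (f x)) := by
      rwa [bddAbove_range_birkhoffSum_apply_iff]
    have htop : Tendsto (fun n => partialSups (birkhoffSum f g) n (f x)) atTop atTop := by
      refine tendsto_atTop_atTop.2 fun b => ?_
      obtain ⟨_, ⟨N, rfl⟩, hN⟩ := not_bddAbove_iff.1 hx' b
      refine ⟨N, fun n hn => hN.le.trans ?_⟩
      exact le_partialSups_of_le (birkhoffSum f g) hn (f x)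
    have hev : ∀ᶠ n in atTop, g x = partialSups (birkhoffSum f g) (n + 1) x -
        partialSups (birkhoffSum f g) n (f x) := by
      filter_upwards [htop.eventually_ge_atTop (-g x)] with n hn
      rw [partialSups_birkhoffSum_succ, max_eq_right (by linarith), add_sub_cancel_right]
    exact tendsto_const_nhds.congr' hev
  -- (c) domination by `|g|`
  have hbound : ∀ n, ∀ᵐ x ∂(μ.restrict D), ‖partialSups (birkhoffSum f g) (n + 1) x -
      partialSups (birkhoffSum f g) n (f x)‖ ≤ |g x| := fun n =>
    ae_of_all _ fun x => by
      rw [Real.norm_eq_abs]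
      exact abs_partialSups_birkhoffSum_succ_sub_le f g n x
  -- (d) dominated convergence
  have hT := tendsto_integral_of_dominated_convergence (fun x => |g x|)
      (fun n => (hΔint n).aestronglyMeasurable) hg.abs.restrict hbound hlim
  exact ge_of_tendsto' hT hnonneg

end MaximalInequality

section Pointwise

variable {α : Type*} [MeasurableSpace α] {f : α → α} {g : α → ℝ} {μ : Measure α}
  [IsProbabilityMeasure μ]

/-- Upper half of the pointwise ergodic theorem for a measurable integrable `g`: for `ε > 0`,
a.e. the Birkhoff averages are eventually `< E[g | 𝓘] + 2ε`, where `𝓘 = invariants f`.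
Proof (Durrett's proof of his Thm 6.2.1): `h = g - E[g|𝓘] - ε` has `∫_D h = -ε μ(D)` over its
(invariant) divergent set `D`, so the maximal inequality forces `μ(D) = 0`; off `D` the sums
`Sₙ h ≤ B` give `Aₙ g < E[g|𝓘] + 2ε` for large `n`. [cite: Durrett2019, Thm 6.2.1 (proof)] -/
theorem ae_eventually_birkhoffAverage_lt (hf : MeasurePreserving f μ μ) (hg : Integrable g μ)
    (hgm : Measurable g) {ε : ℝ} (hε : 0 < ε) :
    ∀ᵐ x ∂μ, ∀ᶠ n in atTop,
      birkhoffAverage ℝ f g n x < (μ[g|invariants f]) x + 2 * ε := by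
  have hcm' : Measurable[invariants f] (μ[g|invariants f]) :=
    stronglyMeasurable_condExp.measurable
  have hcm : Measurable (μ[g|invariants f]) := hcm'.mono (invariants_le f) le_rfl
  have hcinv : (μ[g|invariants f]) ∘ f = μ[g|invariants f] :=
    comp_eq_of_measurable_invariants hcm'
  have hcint : Integrable (μ[g|invariants f]) μ := integrable_condExp
  -- the auxiliary observable `h = g - E[g|𝓘] - ε`
  set h : α → ℝ := g - μ[g|invariants f] - fun _ => ε with hh
  have hhint : Integrable h μ := (hg.sub hcint).sub (integrable_const ε)
  have hhm : Measurable h := (hgm.sub hcm).sub measurable_const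
  -- its divergent set is null
  set D := {x | ¬ BddAbove (range fun n => birkhoffSum f h n x)} with hD
  have hDI : MeasurableSet[invariants f] D :=
    measurableSet_invariants_not_bddAbove_birkhoffSum hf.measurable hhm
  have hD0 : μ D = 0 := by
    have h1 : 0 ≤ ∫ x in D, h x ∂μ :=
      setIntegral_nonneg_of_not_bddAbove_birkhoffSum hf hhint hhm
    have h2 : ∫ x in D, h x ∂μ = -(ε * μ.real D) := by
      have i1 : Integrable (fun x => g x - (μ[g|invariants f]) x) (μ.restrict D) :=
        (hg.sub hcint).restrict
      have i2 : Integrable (fun _ : α => ε) (μ.restrict D) := integrable_const ε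
      simp only [hh, Pi.sub_apply]
      rw [integral_sub i1 i2, integral_sub hg.restrict hcint.restrict,
        setIntegral_condExp (invariants_le f) hg hDI, setIntegral_const, sub_self, zero_sub,
        smul_eq_mul, mul_comm]
    have h3 : μ.real D = 0 :=
      le_antisymm (by nlinarith [measureReal_nonneg (μ := μ) (s := D)]) measureReal_nonneg
    exact (measureReal_eq_zero_iff (measure_ne_top μ D)).1 h3
  have hae : ∀ᵐ x ∂μ, x ∉ D := compl_mem_ae_iff.2 hD0
  filter_upwards [hae] with x hx
  simp only [hD, mem_setOf_eq, not_not] at hx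
  obtain ⟨B, hB⟩ := hx
  obtain ⟨N, hN⟩ := exists_nat_gt (B / ε)
  filter_upwards [eventually_ge_atTop (max N 1)] with n hn
  have hn1 : 1 ≤ n := le_of_max_le_right hn
  have hnN : N ≤ n := le_of_max_le_left hn
  have hnpos : (0 : ℝ) < n := by exact_mod_cast hn1
  have hSle : birkhoffSum f h n x ≤ B := hB ⟨n, rfl⟩
  have hS : birkhoffSum f h n x =
      birkhoffSum f g n x - n * (μ[g|invariants f]) x - n * ε := by
    simp only [hh]
    rw [birkhoffSum_sub, birkhoffSum_sub, congrFun (birkhoffSum_of_comp_eq hcinv n) x]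
    simp [birkhoffSum, nsmul_eq_mul]
  have hB' : B < n * ε := by
    calc B < N * ε := by rwa [div_lt_iff₀ hε] at hN
      _ ≤ n * ε := by gcongr
  rw [hS] at hSle
  simp only [birkhoffAverage, smul_eq_mul]
  rw [inv_mul_lt_iff₀ hnpos]
  nlinarith

/-- Pointwise ergodic theorem for a *measurable* integrable observable: the Birkhoff averages
converge a.e. to the conditional expectation `E[g | invariants f]` (upper bound for `g`, lower
bound from the upper bound for `-g`, `ε = 1/(k+1)`). [cite: Durrett2019, Thm 6.2.1] -/
theorem ae_tendsto_birkhoffAverage_condExp_of_measurable (hf : MeasurePreserving f μ μ)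
    (hg : Integrable g μ) (hgm : Measurable g) :
    ∀ᵐ x ∂μ, Tendsto (fun n => birkhoffAverage ℝ f g n x) atTop
      (𝓝 ((μ[g|invariants f]) x)) := by
  have hup : ∀ k : ℕ, ∀ᵐ x ∂μ, ∀ᶠ n in atTop,
      birkhoffAverage ℝ f g n x < (μ[g|invariants f]) x + 2 * (1 / ((k : ℝ) + 1)) :=
    fun k => ae_eventually_birkhoffAverage_lt hf hg hgm (by positivity)
  have hlow : ∀ k : ℕ, ∀ᵐ x ∂μ, ∀ᶠ n in atTop,
      (μ[g|invariants f]) x - 2 * (1 / ((k : ℝ) + 1)) < birkhoffAverage ℝ f g n x := by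
    intro k
    have h1 := ae_eventually_birkhoffAverage_lt hf hg.neg hgm.neg
      (ε := 1 / ((k : ℝ) + 1)) (by positivity)
    have h2 := condExp_neg (μ := μ) g (invariants f)
    filter_upwards [h1, h2] with x hx1 hx2
    filter_upwards [hx1] with n hn
    rw [hx2] at hn
    simp only [Pi.neg_apply, birkhoffAverage_neg] at hn
    linarith
  rw [← ae_all_iff] at hup hlow
  filter_upwards [hup, hlow] with x hxu hxl
  rw [tendsto_order]
  constructor
  · intro a ha
    obtain ⟨k, hk⟩ := exists_nat_one_div_lt (show 0 < ((μ[g|invariants f]) x - a) / 2 by linarith)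
    filter_upwards [hxl k] with n hn
    linarith
  · intro a ha
    obtain ⟨k, hk⟩ := exists_nat_one_div_lt (show 0 < (a - (μ[g|invariants f]) x) / 2 by linarith)
    filter_upwards [hxu k] with n hn
    linarith

/-- **Pointwise ergodic theorem, conditional-expectation form** (Birkhoff 1931; Durrett 2019
Thm 6.2.1, a.s. part; Dajani–Kalle Thm 3.1.1 with Remark 3.1.1 (i)): for a measure preserving
`f` on a probability space and `g ∈ L¹(μ)`, the Birkhoff averages `(1/n) ∑_{k<n} g (f^[k] x)`
converge for a.e. `x` to `E[g | 𝓘](x)`, `𝓘 = MeasurableSpace.invariants f` the σ-algebra of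
`f`-invariant measurable sets. [cite: Durrett2019, Thm 6.2.1] -/
theorem ae_tendsto_birkhoffAverage_condExp (hf : MeasurePreserving f μ μ) (hg : Integrable g μ) :
    ∀ᵐ x ∂μ, Tendsto (fun n => birkhoffAverage ℝ f g n x) atTop
      (𝓝 ((μ[g|invariants f]) x)) := by
  have hg1 : AEStronglyMeasurable g μ := hg.aestronglyMeasurable
  have hg' : Integrable (hg1.mk g) μ := hg.congr hg1.ae_eq_mk
  have h1 := ae_tendsto_birkhoffAverage_condExp_of_measurable hf hg'
    hg1.stronglyMeasurable_mk.measurable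
  have h2 : μ[hg1.mk g|invariants f] =ᵐ[μ] μ[g|invariants f] :=
    condExp_congr_ae hg1.ae_eq_mk.symm
  have h3 : ∀ᵐ x ∂μ, ∀ n, birkhoffAverage ℝ f (hg1.mk g) n x = birkhoffAverage ℝ f g n x :=
    ae_all_iff.2 fun n =>
      hf.quasiMeasurePreserving.birkhoffAverage_ae_eq_of_ae_eq ℝ hg1.ae_eq_mk.symm n
  filter_upwards [h1, h2, h3] with x hx1 hx2 hx3
  simpa only [hx2, hx3] using hx1

end Pointwise

/-- **Discharge of `birkhoff_ergodic_theorem`** (Dajani–Kalle Thm 3.1.1, first part), with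
`f* = E[φ | invariants f]` (their Remark 3.1.1 (i)): integrable, strictly `f`-invariant
(a function measurable for the invariant σ-algebra satisfies `f* ∘ f = f*`), same integral
(`∫ E[φ|𝓘] = ∫ φ`), and a.e. limit of the Birkhoff averages.
[cite: DajaniKalle2021, Thm 3.1.1] -/
theorem birkhoff_ergodic_theorem_holds : birkhoff_ergodic_theorem.{u} := by
  intro M _ μ _ f hf φ hφ
  refine ⟨μ[φ|invariants f], integrable_condExp, ?_, integral_condExp (invariants_le f), ?_⟩
  · exact comp_eq_of_measurable_invariants stronglyMeasurable_condExp.measurable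
  · exact ae_tendsto_birkhoffAverage_condExp hf hφ

/-- **Discharge of `birkhoff_ergodic_theorem_of_ergodic`** (Dajani–Kalle Thm 3.1.1, second
part): if `f` is ergodic the invariant limit `f*` is a.e. a constant, which must be `∫ φ dμ`.
[cite: DajaniKalle2021, Thm 3.1.1] -/
theorem birkhoff_ergodic_theorem_of_ergodic_holds : birkhoff_ergodic_theorem_of_ergodic.{u} := by
  intro M _ μ _ f hf φ hφ
  obtain ⟨φstar, hint, hinv, hI, hae⟩ :=
    birkhoff_ergodic_theorem_holds μ f hf.toMeasurePreserving φ hφ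
  obtain ⟨c, hc⟩ := hf.ae_eq_const_of_ae_eq_comp_ae hint.aestronglyMeasurable
    (Eventually.of_forall fun x => congrFun hinv x)
  have hcI : c = ∫ y, φ y ∂μ := by
    rw [← hI, integral_congr_ae hc]
    simp
  filter_upwards [hae, hc] with x hx hxc
  rw [hxc, Function.const_apply, hcI] at hx
  exact hx

end Literature.Dynamics.Ergodic

end
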